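import Summits.NavierStokesRegularity.NavierStokesRegularity.Theorems.TypeIQuarterGateQuarterLawTypeIWindowLaw
import Summits.NavierStokesRegularity.NavierStokesRegularity.Theorems.TypeIQuarterGateLorentzUpgradeIffQuarterLaw
import Summits.NavierStokesRegularity.NavierStokesRegularity.Theorems.TypeIQuarterGateFiniteScarsTypeIOfQuarterLaw
import HarnessLib

/-!
# `TypeIQuarterGate`: what the energy ½-Hölder law (`EnergyHalfHolder`, 25161) decides on the Type-I shelf

`--supports stmt-NavierStokesRegularity-23726` (by-name bookkeeping; sequel to
`…QuarterLawTypeIWindowLaw.lean`, p820364).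

With `QuarterLawWindow.quarterLawTypeI_of_energyHalfHolder` (25161 ⟹ 23726) and the fixed-point
equivalences of the registered line `lorentz-upgrade` (`LorentzOfEnvelope.lorentz_cruxes_tfae`:
24108 ⟺ 23726 ⟺ 23970) and K1 ⟹ S1 (`finiteScarsTypeI_of_quarterLawTypeI`, 23726 ⟹ 23842), the
crux `EnergyHalfHolder` of route `HalfHolderEnergy` settles, BY NAME, every Type-I item of this route
except the envelope 23843 and the residuals 0893 / 0056:

* `lorentzUpgradeTypeI_of_energyHalfHolder` — 25161 ⟹ 24108 (the open registered stub
  `stub_lorentzUpgrade` of 23726's line);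
* `uniformConcentrationCountTypeI_of_energyHalfHolder` — 25161 ⟹ 23970;
* `finiteScarsTypeI_of_energyHalfHolder` — 25161 ⟹ 23842;
* `energyHalfHolder_typeI_package` — the conjunction.

HONEST FRAMING: implications between OPEN statements; nothing about Navier–Stokes regularity is
claimed. [folklore]
-/

-- the problem directory repeats the summit name (`NavierStokesRegularity/NavierStokesRegularity`)
set_option linter.dupNamespace false

namespace Summit.NavierStokesRegularity.NavierStokesRegularity.Theorems

namespace QuarterLawWindow

open Summit.NavierStokesRegularity.NavierStokesRegularity.Theses.TypeIQuarterGate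
open Summit.NavierStokesRegularity.NavierStokesRegularity.Theses.HalfHolderEnergy (EnergyHalfHolder)

/-- **25161 ⟹ 24108**: the energy ½-Hölder law gives the Lorentz upgrade on Type-I blow-ups (hence
closes the open stub `stub_lorentzUpgrade` of the line `lorentz-upgrade` conditionally on 25161).
[folklore] -/
theorem lorentzUpgradeTypeI_of_energyHalfHolder (h : EnergyHalfHolder) : LorentzUpgradeTypeI :=
  LorentzOfEnvelope.lorentzUpgradeTypeI_of_quarterLawTypeI (quarterLawTypeI_of_energyHalfHolder h)

/-- **25161 ⟹ 23970**: the energy ½-Hölder law gives the scale-uniform ε-concentration count on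
Type-I blow-ups. [folklore] -/
theorem uniformConcentrationCountTypeI_of_energyHalfHolder (h : EnergyHalfHolder) :
    UniformConcentrationCountTypeI :=
  (CountQuarterLaw.quarterLawTypeI_iff_uniformConcentrationCountTypeI).1
    (quarterLawTypeI_of_energyHalfHolder h)

/-- **25161 ⟹ 23842**: the energy ½-Hölder law gives finitely many scars on Type-I blow-ups.
[folklore] -/
theorem finiteScarsTypeI_of_energyHalfHolder (h : EnergyHalfHolder) : FiniteScarsTypeI :=
  finiteScarsTypeI_of_quarterLawTypeI (quarterLawTypeI_of_energyHalfHolder h)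

/-- **The Type-I package of `EnergyHalfHolder`**: 25161 ⟹ 23726 ∧ 24108 ∧ 23970 ∧ 23842. [folklore] -/
theorem energyHalfHolder_typeI_package (h : EnergyHalfHolder) :
    QuarterLawTypeI ∧ LorentzUpgradeTypeI ∧ UniformConcentrationCountTypeI ∧ FiniteScarsTypeI :=
  ⟨quarterLawTypeI_of_energyHalfHolder h, lorentzUpgradeTypeI_of_energyHalfHolder h,
    uniformConcentrationCountTypeI_of_energyHalfHolder h, finiteScarsTypeI_of_energyHalfHolder h⟩

end QuarterLawWindow

end Summit.NavierStokesRegularity.NavierStokesRegularity.Theorems
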